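import Summits.ABC.ABC.Theses.CubicResolventAllowance
import Literature.NumberTheory.Automorphic.BCDTModularity
import Literature.NumberTheory.GaloisRepresentations.ModPGaloisRep
import HarnessLib

/-!
# stub-ideation k2 (RESHAPE) — generation 20 sketch for `stub_complexCubic` (crux `IndexSzpiro`, stmt-ABC-22740)

Companion to `STUB-IDEAS-stub_complexCubic-2.md` (gen 20).  Gens 1–19 stand by reference.  The one typed
cell of gen 20 is the SERRE-LEVEL FAMILY reading of the stub ("change the prime in the allowance"):
`|d_K| = 2^{a}·N(ρ̄_{W,2})` (k1 G4 S1; conductor–discriminant formula for the `S₃` cubic field), so the stub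
is the `ℓ = 2`, `(A, κ) = (1, 6+ε)` member `SigmaTwo 1 6` of the two-parameter family
`Δ_min ≤ C · N(ρ̄_{W,ℓ})^A · N_W^{κ+ε}`, whose PURE-ALLOWANCE members `(K, 0)` at ONE prime `ℓ ≥ 7` are
route LevelLoweredSzpiro's crux `SerreLevelSzpiro`.  At `ℓ = 2` (`X(2) ≅ ℙ¹`: no moduli/Riemann–Hurwitz
dictionary) the pure-allowance member is FALSE for every exponent: `not_pureAllowance` below, sorry-free
from the gen-7 tower `deepEvenComplexFamily` (`d_K` fixed, `|d_K| ∣ 1944`, `Δ_min → ∞`).  So at `ℓ = 2` the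
`N^{6+ε}` term is the whole statement; the allowance is a parity decoration of size `≤ 1944 N²`.

`lean check`: see the .md (§2).  Sorries only in `D1`-dependent glue marked (S).
-/

open Polynomial
open Literature.NumberTheory.GaloisRepresentations (ModPGaloisRep)
open Literature.NumberTheory.GaloisRepresentations.ModPGaloisRep (serreLevel)

namespace Summit.ABC.ABC.Cruxes.IndexSzpiro.StubIdeas2G20

open Summit.ABC.ABC.Theses.CubicResolventAllowance (IndexSzpiro)
open WeierstrassCurve

/-! ## §0  The stub (verbatim) and the gen-7 tower as a NAMED INPUT

Crux-directory sketches are not modules of the farm build, so the gen-7 theorem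
`StubIdeas2G7.deepEvenComplexFamily` (VERIFIED there, rc 0) is restated here as the Prop
`DeepEvenComplexFamily` and consumed as a hypothesis; `exists_resolventField` is re-proved verbatim. -/

/-- `stub_complexCubic`, verbatim (registered signature, skeleton sha d34fb8f2…). -/
def Stub : Prop :=
  ∀ ε : ℝ, 0 < ε → ∃ C : ℝ, ∀ (W : WeierstrassCurve ℚ) [W.IsElliptic] (K : Type) [Field K] [NumberField K],
    Irreducible W.twoTorsionPolynomial.toPoly → Module.finrank ℚ K = 3 →
    (∃ θ : K, aeval θ W.twoTorsionPolynomial.toPoly = 0) → NumberField.discr K < 0 →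
    (W.minimalDiscriminantNorm ℤ : ℝ) ≤ C * |(NumberField.discr K : ℝ)| * (W.conductorNorm ℤ : ℝ) ^ (6 + ε)

/-- (VERIFIED, trivial) the crux gives the stub by forgetting the sign. -/
theorem stub_of_indexSzpiro (h : IndexSzpiro) : Stub := by
  intro ε hε
  obtain ⟨C, hC⟩ := h ε hε
  exact ⟨C, fun W _ K _ _ hirr h3 hθ _ => hC W K hirr h3 hθ⟩

/-- The gen-7 tower (k2 `StubIdeas2G7Sketch.deepEvenComplexFamily`, VERIFIED there): for every `j` a curve in
the complex `r = 0` class whose stem fields all satisfy `|d_K| ∣ 1944`, with `2^{6j+3} N⁶ ≤ 3²¹ Δ_min`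
(Hesse models `y² + 3a·xy + (a³−n³)·y = x³` along the doubling orbit of `(−63/4, 351/8)` on `Y² = X³ + 18³`). -/
def DeepEvenComplexFamily : Prop :=
  ∀ j : ℕ, ∃ (W : WeierstrassCurve ℚ) (_ : W.IsElliptic), Irreducible W.twoTorsionPolynomial.toPoly ∧
      (∀ (K : Type) [Field K] [NumberField K], Module.finrank ℚ K = 3 →
        (∃ θ : K, aeval θ W.twoTorsionPolynomial.toPoly = 0) →
          NumberField.discr K < 0 ∧ (NumberField.discr K).natAbs ∣ 1944) ∧
      2 ^ (6 * j + 3) * W.conductorNorm ℤ ^ 6 ≤ 3 ^ 21 * W.minimalDiscriminantNorm ℤ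

/-- (VERIFIED; = k2 gen 5/7 `exists_resolventField`) a stem field of the irreducible 2-division cubic. -/
theorem exists_resolventField (W : WeierstrassCurve ℚ) (hirr : Irreducible W.twoTorsionPolynomial.toPoly) :
    ∃ (K : Type) (_ : Field K) (_ : NumberField K),
      Module.finrank ℚ K = 3 ∧ ∃ θ : K, aeval θ W.twoTorsionPolynomial.toPoly = 0 := by
  haveI : Fact (Irreducible W.twoTorsionPolynomial.toPoly) := ⟨hirr⟩
  have hdeg : W.twoTorsionPolynomial.toPoly.natDegree = 3 :=
    Cubic.natDegree_of_a_ne_zero (by norm_num [WeierstrassCurve.twoTorsionPolynomial])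
  have hfin : Module.finrank ℚ (AdjoinRoot W.twoTorsionPolynomial.toPoly) = 3 := by
    rw [(AdjoinRoot.powerBasis hirr.ne_zero).finrank, AdjoinRoot.powerBasis_dim, hdeg]
  have hroot := AdjoinRoot.aeval_eq (f := W.twoTorsionPolynomial.toPoly) W.twoTorsionPolynomial.toPoly
  rw [AdjoinRoot.mk_self] at hroot
  have keyfin : ∀ inst : Module ℚ (AdjoinRoot W.twoTorsionPolynomial.toPoly),
      @Module.finrank ℚ (AdjoinRoot W.twoTorsionPolynomial.toPoly) _ _ inst = 3 := by
    intro inst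
    obtain rfl := Subsingleton.elim inst
      (@Algebra.toModule _ _ _ _ (AdjoinRoot.instAlgebra W.twoTorsionPolynomial.toPoly))
    exact hfin
  have keyroot : ∀ inst : Algebra ℚ (AdjoinRoot W.twoTorsionPolynomial.toPoly),
      @aeval ℚ (AdjoinRoot W.twoTorsionPolynomial.toPoly) _ _ inst
        (AdjoinRoot.root W.twoTorsionPolynomial.toPoly) W.twoTorsionPolynomial.toPoly = 0 := by
    intro inst
    obtain rfl := Subsingleton.elim inst (AdjoinRoot.instAlgebra W.twoTorsionPolynomial.toPoly)
    exact hroot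
  exact ⟨AdjoinRoot W.twoTorsionPolynomial.toPoly, inferInstance, inferInstance, keyfin _,
    AdjoinRoot.root _, keyroot _⟩

/-! ## §1  The pure-allowance member at `ℓ = 2` is false (sorry-free modulo the named gen-7 tower) -/

/-- `PureAllowance A`: ONE constant bounds `Δ_min` by the `A`-th power of the resolvent discriminant alone on the
complex `r = 0` class — the multiplicative form, at `ℓ = 2`, of the shape of
`LevelLoweredSzpiro.SerreLevelSzpiro` (`log|Δ_min| ≤ K·log(ℓ·N(ρ̄_{E,ℓ})) + C` at one `ℓ ≥ 7`). -/
def PureAllowance (A : ℕ) : Prop :=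
  ∃ C : ℝ, ∀ (W : WeierstrassCurve ℚ) [W.IsElliptic] (K : Type) [Field K] [NumberField K],
    Irreducible W.twoTorsionPolynomial.toPoly → Module.finrank ℚ K = 3 →
    (∃ θ : K, aeval θ W.twoTorsionPolynomial.toPoly = 0) → NumberField.discr K < 0 →
    (W.minimalDiscriminantNorm ℤ : ℝ) ≤ C * |(NumberField.discr K : ℝ)| ^ A

/-- **N20 (VERIFIED from the gen-7 tower F7).**  No exponent `A` makes the pure allowance work at `ℓ = 2`:
on `deepEvenComplexFamily j` every stem field has `d_K < 0`, `|d_K| ∣ 1944`, while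
`2^{6j+3} ≤ 2^{6j+3} N⁶ ≤ 3²¹ Δ_min`. -/
theorem not_pureAllowance (hF : DeepEvenComplexFamily) (A : ℕ) : ¬ PureAllowance A := by
  rintro ⟨C, hC⟩
  obtain ⟨j, hj⟩ := pow_unbounded_of_one_lt (3 ^ 21 * (max C 0 * 1944 ^ A)) (by norm_num : (1 : ℝ) < 2)
  obtain ⟨W, hE, hirr, hK, hineq⟩ := hF j
  haveI := hE
  obtain ⟨K, _, _, h3, hθ⟩ := exists_resolventField W hirr
  obtain ⟨hneg, hdvd⟩ := hK K h3 hθ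
  have h1 := hC W K hirr h3 hθ hneg
  have hdK : |(NumberField.discr K : ℝ)| ≤ 1944 := by
    have h := Nat.le_of_dvd (by norm_num) hdvd
    rw [← Int.cast_abs, Int.abs_eq_natAbs]
    exact_mod_cast h
  have hdKA : |(NumberField.discr K : ℝ)| ^ A ≤ 1944 ^ A := by
    gcongr
  have hN1 : (1 : ℝ) ≤ (W.conductorNorm ℤ : ℝ) := by
    have h := conductorNorm_pos_holds W
    exact_mod_cast h
  have hN6 : (1 : ℝ) ≤ (W.conductorNorm ℤ : ℝ) ^ 6 := one_le_pow₀ hN1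
  have hineqR : (2 : ℝ) ^ (6 * j + 3) * (W.conductorNorm ℤ : ℝ) ^ 6 ≤
      3 ^ 21 * (W.minimalDiscriminantNorm ℤ : ℝ) := by exact_mod_cast hineq
  have hC0 : 0 ≤ max C 0 := le_max_right _ _
  have h2 : (W.minimalDiscriminantNorm ℤ : ℝ) ≤ max C 0 * 1944 ^ A :=
    calc (W.minimalDiscriminantNorm ℤ : ℝ)
        ≤ C * |(NumberField.discr K : ℝ)| ^ A := h1
      _ ≤ max C 0 * |(NumberField.discr K : ℝ)| ^ A := by
          gcongr; exact le_max_left _ _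
      _ ≤ max C 0 * 1944 ^ A := by gcongr
  have h20 : (0 : ℝ) ≤ (2 : ℝ) ^ (6 * j + 3) := by positivity
  have h4 : (2 : ℝ) ^ (6 * j + 3) ≤ 3 ^ 21 * (max C 0 * 1944 ^ A) :=
    calc (2 : ℝ) ^ (6 * j + 3) = (2 : ℝ) ^ (6 * j + 3) * 1 := by ring
      _ ≤ (2 : ℝ) ^ (6 * j + 3) * (W.conductorNorm ℤ : ℝ) ^ 6 := by gcongr
      _ ≤ 3 ^ 21 * (W.minimalDiscriminantNorm ℤ : ℝ) := hineqR
      _ ≤ 3 ^ 21 * (max C 0 * 1944 ^ A) := by gcongr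
  have h6 : (2 : ℝ) ^ j ≤ 2 ^ (6 * j + 3) := pow_le_pow_right₀ (by norm_num) (by omega)
  linarith

/-! ## §2  The Serre-level family at `ℓ = 2` (typed; glue modulo the dictionary D1) -/

/-- `SigmaTwo A κ`: for every `ε > 0` one constant `C` with
`Δ_min(W) ≤ C · N(ρ̄_{W,2})^A · N_W^{κ+ε}` for every `W/ℚ` in the complex `r = 0` class (`ψ₂` irreducible,
`Δ < 0` — the sign of `Δ` is model-independent) and every FRAMED mod-2 representation `ρ̄` of `W`
(`WeierstrassCurve.IsTorsionGaloisRep`, tree; `serreLevel 2 ρ̄` = prime-to-2 Artin conductor, tree). -/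
def SigmaTwo (A κ : ℝ) : Prop :=
  ∀ ε : ℝ, 0 < ε → ∃ C : ℝ, ∀ (W : WeierstrassCurve ℚ) [W.IsElliptic] (ρ : ModPGaloisRep ℚ (ZMod 2) 2),
    W.IsTorsionGaloisRep 2 ρ → Irreducible W.twoTorsionPolynomial.toPoly → W.Δ < 0 →
    (W.minimalDiscriminantNorm ℤ : ℝ) ≤ C * (serreLevel 2 ρ : ℝ) ^ A * (W.conductorNorm ℤ : ℝ) ^ (κ + ε)

/-- `SigmaTwoPure`: verbatim the shape of `LevelLoweredSzpiro.SerreLevelSzpiro` with `ℓ = 2` (log form, no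
conductor term), on the complex `r = 0` class. -/
def SigmaTwoPure : Prop :=
  ∃ K C : ℝ, ∀ (W : WeierstrassCurve ℚ) [W.IsElliptic] (ρ : ModPGaloisRep ℚ (ZMod 2) 2),
    W.IsTorsionGaloisRep 2 ρ → Irreducible W.twoTorsionPolynomial.toPoly → W.Δ < 0 →
    Real.log (W.minimalDiscriminantNorm ℤ : ℝ) ≤ K * Real.log (2 * (serreLevel 2 ρ : ℝ)) + C

/-- **D1 (dictionary, L; = k1 G4 S1 in Serre-level language).**  For `ψ₂(W)` irreducible, `K` a cubic stem
field and `ρ̄` a framed `ρ̄_{W,2}`: `|d_K| = 2^a · N(ρ̄)` with `a ≤ 3` (conductor–discriminant formula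
`ζ_K = ζ · L(ρ_std)`, the mod-2 standard representation of `S₃ ≅ GL₂(𝔽₂)` has the same Artin exponents at odd
primes as its integral lift; `v₂(d_K) ≤ 3`). -/
def SerreLevelTwoDictionary : Prop :=
  ∀ (W : WeierstrassCurve ℚ) [W.IsElliptic] (ρ : ModPGaloisRep ℚ (ZMod 2) 2), W.IsTorsionGaloisRep 2 ρ →
    ∀ (K : Type) [Field K] [NumberField K], Irreducible W.twoTorsionPolynomial.toPoly →
      Module.finrank ℚ K = 3 → (∃ θ : K, aeval θ W.twoTorsionPolynomial.toPoly = 0) →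
      ∃ a : ℕ, a ≤ 3 ∧ (NumberField.discr K).natAbs = 2 ^ a * serreLevel 2 ρ

/-- **G1 (S, glue modulo D1).**  The stub IS the `(1, 6+ε)` member at `ℓ = 2`: `2^a ≤ 8` is absorbed in `C`;
the sign transfer `d_K < 0 ↔ Δ < 0` is k2 G4 `discr_neg_iff_Δ_neg` (via `Δ = q²·d_K`, k1 G5 K6); framed
`ρ̄_{W,2}` exist (`WeierstrassCurve.exists_isTorsionGaloisRep`), stem fields exist (`exists_resolventField`). -/
theorem stub_iff_sigmaTwo (hD : SerreLevelTwoDictionary) : Stub ↔ SigmaTwo 1 6 := by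
  sorry

/-- **N20′ (S, modulo the named tower F7 and D1).**  The `ℓ = 2` analogue of `SerreLevelSzpiro` is false on
the complex class: on `deepEvenComplexFamily j`, `N(ρ̄) ≤ |d_K| ≤ 1944` while `Δ_min ≥ 2^{6j+3}/3²¹`.  Remaining
glue for a full proof: framed `ρ̄_{W,2}` exist (`WeierstrassCurve.exists_isTorsionGaloisRep`, tree) and the sign
transfer `d_K < 0 → Δ(W) < 0` (k2 G4 `discr_neg_iff_Δ_neg`, crux-dir sketch, not a farm module). -/
theorem not_sigmaTwoPure (hF : DeepEvenComplexFamily) (hD : SerreLevelTwoDictionary) : ¬ SigmaTwoPure := by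
  sorry

end Summit.ABC.ABC.Cruxes.IndexSzpiro.StubIdeas2G20
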